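import Mathlib
import Literature.NumberTheory.LFunctions.DirichletLogDerivDisc
import Literature.NumberTheory.LFunctions.Zhang2022.Section5VerticalShift
import Literature.NumberTheory.LFunctions.Zhang2022.Section5Lemma59ZeroSum
import HarnessLib

/-!
# Zhang (2022), §5, Lemma 5.9: "`L(s+β₁,ψ)/L(s,ψ) ≪ log P`" — the proof's structure made exact
# (partial fraction (5.16) integrated along `[s, s+β₁]`), and the lemma under Proposition 2.2,
# kernel-checked

Topic `Literature/NumberTheory/LFunctions/Zhang2022` (Landau–Siegel autopsy tree; verdict-neutral).
Y. Zhang, *Discrete mean estimates and the Landau–Siegel zero*, arXiv:2211.02515v1 (2022) — **an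
unrefereed manuscript, a claimed result under adjudication** (cell pub-zhang: audit + repair census
of arXiv:2211.02515; no claim about Landau–Siegel) — §5 p. 11:

> Lemma 5.9. Suppose `ψ ∈ Ψ₁`, `|σ − 1/2| ≤ α`, `|t − 2πt₀| ≤ 𝓛₁ + 10` and `|s − ρ| ≫ α` for any zero
> `ρ` of `L(s,ψ)`. Then `L(s+β₁,ψ)/L(s,ψ) ≪ log P`.
> Proof. It is known that `L′/L(s′,ψ) = Σ_{|ρ−s′|<1} 1/(s′−ρ) + O(1/α)`   (5.16)
> for `|Re{s′} − 1/2| ≤ α` and `|Im{s′ − 2πt₀}| < 𝓛₁ + 10`, where `ρ` runs through the zeros of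
> `L(s′,ψ)`. We can assume `L(s+β₁,ψ) ≠ 0`. Suppose `σ ≥ 1/2`. By (5.16), […three displays…].
> Combining these estimates we obtain the result. In the case `σ < 1/2` the proof is analogous.

(`β₁ = iv₁`, `v₁ = α(1−5c′α𝓛)` (2.13); `ψ ∈ Ψ₁` carries Proposition 2.2: the zeros near `s` lie on
the critical line, are simple, and consecutive ones are `α + O(c′α²𝓛)` apart; `α = π/log P` (2.10).)

INPUT FROM THE TREE in place of "It is known that (5.16)": Montgomery–Vaughan Lemma 12.1 for
`L(s,χ)` in disc form, `Literature.NumberTheory.LFunctions.DirichletDisc.exists_norm_logDeriv_sub_sum_le`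
(`DirichletLogDerivDisc.lean`): an absolute `C` with
`‖L′/L(s′,χ) − Σ_{ρ ∈ 𝒵} m(ρ)/(s′−ρ)‖ ≤ C(log q + log(|t|+4))` for `|s′ − (2+it)| ≤ 38/25`, `L(s′,χ) ≠ 0`,
`𝒵 = discZeros χ t` the zeros in `|ρ − (2+it)| ≤ 81/50` with multiplicities `m = discDivisor χ t`
(for `χ` mod `p ~ P` at the manuscript's heights, `C(log p + log(|t|+4)) = O(log P) = O(1/α)`).

This file PROVES, for any `χ ≠ χ₀` mod `q ≥ 1`, `s = σ + it` with `|σ − 1/2| ≤ 1/100`, a vertical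
shift `0 < v ≤ 1/100`, and `L(·,χ)` zero-free on the closed segment `[s, s + iv]`:

* `Lemma59.exists_abs_log_norm_sub_le` — **the proof's structure, EXACT**: with the SAME absolute `C`,
  `|log|L(s+iv,χ)| − log|L(s,χ)| − Σ_{ρ∈𝒵} m(ρ)(log|s+iv−ρ| − log|s−ρ|)| ≤ C(log q + log(|t|+4))·v`
  — (5.16) integrated along the segment (`L(s+iv) = L(s)·exp(i∫₀^v L′/L(s+iy)dy)`, the tree's
  `Zhang2022.eq_mul_exp_I_mul_integral_logDeriv`), the main term `Σ m(ρ)∫ Re` evaluated EXACTLY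
  (`|s+iy−ρ| = |s−ρ|·exp Re(i∫ dy/(s+iy−ρ))`), the remainder bounded by `C·ℒ·(length v)`; no
  hypothesis on the zeros;
* `Lemma59.log_norm_sub_le_of_prop22` — **Lemma 5.9 under Proposition 2.2 (i)–(iii) on the disc**:
  if every `ρ ∈ 𝒵` has `Re ρ = 1/2` and `m(ρ) = 1`, distinct ordinates differ by `≥ g > 0`, and
  `|s − ρ| ≥ r` (`0 < r ≤ 81/50`) for all `ρ ∈ 𝒵`, then with `a = σ − 1/2`, `|a| ≤ α`,
  `log|L(s+iv,χ)| − log|L(s,χ)| ≤ C·ℒ·v + ((r+v/2)/g + 1)·½log((α²+(r+v)²)/r²) + v/r + (v/g)log((81/50)/r)`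
  `                                  + (v²/2)(1/r² + 1/(gr))`
  (the zero sum is `Lemma59.sum_logRatio_le` of `Section5Lemma59ZeroSum` — the three displays in
  signed form), and `Lemma59.norm_le_of_prop22` — the exponentiated form;
* `Lemma59.norm_le_on_J` — **the form used at (8.1) on `𝔍(±α)`**: `|σ − 1/2| = α > 0` (so
  `|s−ρ| ≥ α` and the zero-freeness of `[s, s+iv]` are automatic), `0 < v ≤ min(g, α)`, `α/2 ≤ g`,
  `α ≤ 1/100`:
  `|L(s+iv,χ)| ≤ |L(s,χ)| · exp(C·ℒ·v + 12)/α`, i.e. `≪ log P` once `ℒ·v = O(1)`, `1/α = (log P)/π`.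

What is NOT asserted: (5.16) in the manuscript's unit-ball form, Proposition 2.2 itself, or the
case of a zero ordinate strictly inside `(t, t+v)` when `σ = 1/2` (the manuscript's three-leg path;
at (8.1) the lemma is used on `𝔍(±α)`, `σ = 1/2 ± α`). Nothing about Theorems 1–2 of the source is
stated or implied; nothing here bears on the cell's verdict on (8.24).

## References

* Y. Zhang, arXiv:2211.02515v1 (2022), §5 p. 11, Lemma 5.9 and (5.16); (2.10), (2.13),
  Proposition 2.2. [cite: Zhang2022LandauSiegel, §5 Lemma 5.9]
* H. L. Montgomery, R. C. Vaughan, *Multiplicative Number Theory I*, CUP 2007, Lemma 12.1 / 12.6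
  (through the tree's `DirichletLogDerivDisc.lean`). [cite: MontgomeryVaughan2007, Lemma 12.6]
-/

noncomputable section

open Complex Real Set Metric Filter _root_.Topology MeasureTheory intervalIntegral Finset

namespace Literature.NumberTheory.LFunctions.Zhang2022

namespace Lemma59

open Literature.NumberTheory.LFunctions.DirichletDisc

/-! ### Geometry of the segment `[s, s+iv]` inside the Jensen disc -/

/-- Points `σ + i(t+y)` with `|σ − 1/2| ≤ 1/100`, `0 ≤ y ≤ 1/100` lie in the disc
`|s′ − (2+it)| ≤ 38/25` of the tree's partial fraction. [folklore] -/
private lemma mem_disc {σ t y : ℝ} (hσ : |σ - 1 / 2| ≤ 1 / 100) (hy0 : 0 ≤ y) (hy1 : y ≤ 1 / 100) :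
    (σ : ℂ) + t * I + y * I ∈ closedBall (2 + (t : ℂ) * I) (38 / 25) := by
  rw [Metric.mem_closedBall, dist_eq_norm]
  have e : (σ : ℂ) + t * I + y * I - (2 + t * I) = ((σ - 2 : ℝ) : ℂ) + (y : ℂ) * I := by
    push_cast; ring
  rw [e, Complex.norm_add_mul_I, Real.sqrt_le_left]
  · nlinarith [abs_le.1 hσ]
  · norm_num

/-! ### The structural identity: (5.16) integrated along the segment -/

/-- **Lemma 5.9's proof, structural form (no hypothesis on the zeros)**: with the absolute constant
`C` of the tree's MV Lemma 12.1 for `L(s,χ)`, for every `χ ≠ χ₀` mod `q`, `s = σ + it` with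
`|σ − 1/2| ≤ 1/100`, `0 < v ≤ 1/100` and `L(·,χ)` zero-free on the segment `[s, s+iv]`,
`|log|L(s+iv,χ)| − log|L(s,χ)| − Σ_{ρ∈𝒵} m(ρ)(log|s+iv−ρ| − log|s−ρ|)| ≤ C(log q + log(|t|+4))·v`,
`𝒵 = discZeros χ t`, `m = discDivisor χ t`. [cite: Zhang2022LandauSiegel, §5 Lemma 5.9 (proof)] -/
theorem exists_abs_log_norm_sub_le :
    ∃ C : ℝ, 0 < C ∧ ∀ (q : ℕ) [NeZero q] (χ : DirichletCharacter ℂ q), χ ≠ 1 →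
      ∀ (σ t v : ℝ), |σ - 1 / 2| ≤ 1 / 100 → 0 < v → v ≤ 1 / 100 →
      (∀ y ∈ Icc (0 : ℝ) v, χ.LFunction ((σ : ℂ) + t * I + y * I) ≠ 0) →
      |Real.log ‖χ.LFunction ((σ : ℂ) + t * I + v * I)‖ - Real.log ‖χ.LFunction ((σ : ℂ) + t * I)‖
          - ∑ ρ ∈ discZeros χ t, (discDivisor χ t ρ : ℝ) *
              (Real.log ‖(σ : ℂ) + t * I + v * I - ρ‖ - Real.log ‖(σ : ℂ) + t * I - ρ‖)|
        ≤ C * (Real.log q + Real.log (|t| + 4)) * v := by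
  obtain ⟨C, hC0, hC⟩ := exists_norm_logDeriv_sub_sum_le
  refine ⟨C, hC0, ?_⟩
  intro q _ χ hχ σ t v hσ hv0 hv1 hseg
  set s : ℂ := (σ : ℂ) + t * I with hs_def
  set Z : Finset ℂ := discZeros χ t with hZ
  set ℒ : ℝ := Real.log q + Real.log (|t| + 4) with hℒ
  set L : ℂ → ℂ := χ.LFunction with hL_def
  have hLdiff : Differentiable ℂ L := DirichletCharacter.differentiable_LFunction hχ
  have hIcc : uIcc (0 : ℝ) v = Icc 0 v := uIcc_of_le hv0.le
  -- the segment lies in the disc and avoids the zeros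
  have hdisc : ∀ y ∈ Icc (0 : ℝ) v, s + y * I ∈ closedBall (2 + (t : ℂ) * I) (38 / 25) :=
    fun y hy => mem_disc hσ hy.1 (hy.2.trans hv1)
  have hne : ∀ y ∈ Icc (0 : ℝ) v, ∀ ρ ∈ Z, s + y * I - ρ ≠ 0 := by
    intro y hy ρ hρ h
    rw [sub_eq_zero] at h
    have h0 := (discZeros_prop hχ hρ).1
    rw [← h] at h0
    exact hseg y hy h0
  -- the integrands
  set F : ℝ → ℂ := fun y => deriv L (s + y * I) / L (s + y * I) with hF
  set G : ℂ → ℝ → ℂ := fun ρ y => (discDivisor χ t ρ : ℂ) / (s + y * I - ρ) with hG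
  set E : ℝ → ℂ := fun y => F y - ∑ ρ ∈ Z, G ρ y with hE
  -- the pointwise bound on the remainder `E` (MV Lemma 12.1, disc form)
  have hEb : ∀ y ∈ Icc (0 : ℝ) v, ‖E y‖ ≤ C * ℒ := by
    intro y hy
    have h := hC q χ hχ t (s + y * I) (hdisc y hy) (hseg y hy)
    simpa [hE, hF, hG, logDeriv_apply] using h
  -- continuity and integrability
  have hz : Continuous fun y : ℝ => s + (y : ℂ) * I := by fun_prop
  have hFc : ContinuousOn F (uIcc 0 v) := by
    rw [hIcc]
    refine ContinuousOn.div ?_ ?_ fun y hy => hseg y hy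
    · exact (hLdiff.deriv.continuous.comp hz).continuousOn
    · exact (hLdiff.continuous.comp hz).continuousOn
  have hGc : ∀ ρ ∈ Z, ContinuousOn (G ρ) (uIcc 0 v) := by
    intro ρ hρ
    rw [hIcc]
    exact continuousOn_const.div ((hz.sub continuous_const).continuousOn) fun y hy => hne y hy ρ hρ
  have hFi : IntervalIntegrable F volume 0 v := hFc.intervalIntegrable
  have hGi : ∀ ρ ∈ Z, IntervalIntegrable (G ρ) volume 0 v := fun ρ hρ => (hGc ρ hρ).intervalIntegrable
  have hSi : IntervalIntegrable (fun y => ∑ ρ ∈ Z, G ρ y) volume 0 v := by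
    rw [show (fun y => ∑ ρ ∈ Z, G ρ y) = ∑ ρ ∈ Z, G ρ from by
      funext y; exact (Finset.sum_apply y Z G).symm]
    exact IntervalIntegrable.sum Z hGi
  have hEi : IntervalIntegrable E volume 0 v := hFi.sub hSi
  -- decomposition of `∫ F`
  have hdecomp : ∫ y in (0 : ℝ)..v, F y
      = (∫ y in (0 : ℝ)..v, E y) + ∑ ρ ∈ Z, ∫ y in (0 : ℝ)..v, G ρ y := by
    have e1 : (fun y => F y) = fun y => E y + ∑ ρ ∈ Z, G ρ y := by
      funext y; simp [hE]
    rw [e1, intervalIntegral.integral_add hEi hSi, intervalIntegral.integral_finsetSum hGi]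
  -- `L(s+iv) = L(s)·exp(i∫F)` and `log|L(s+iv)| = log|L(s)| + Re(i∫F)`
  have hLan : ∀ y ∈ Icc (0 : ℝ) v, AnalyticAt ℂ L (s + y * I) := fun y _ => hLdiff.analyticAt _
  have hmul := eq_mul_exp_I_mul_integral_logDeriv (g := L) (s := s) (u := 0) (v := v) (p := 0) (q := v)
    hLan (fun y hy => hseg y hy) (left_mem_Icc.2 hv0.le) (right_mem_Icc.2 hv0.le)
  have hs0 : s + ((0 : ℝ) : ℂ) * I = s := by simp
  rw [hs0] at hmul
  have hLs : L s ≠ 0 := by simpa using hseg 0 (left_mem_Icc.2 hv0.le)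
  have hLsv : L (s + v * I) ≠ 0 := hseg v (right_mem_Icc.2 hv0.le)
  have hlogL : Real.log ‖L (s + v * I)‖
      = Real.log ‖L s‖ + (I * ∫ y in (0 : ℝ)..v, F y).re := by
    rw [hmul, norm_mul, Complex.norm_exp, Real.log_mul (norm_ne_zero_iff.2 hLs) (Real.exp_pos _).ne',
      Real.log_exp]
  -- the same for each factor `s − ρ`: `log|s+iv−ρ| = log|s−ρ| + Re(i∫ dy/(s+iy−ρ))`
  have hlogρ : ∀ ρ ∈ Z, Real.log ‖s + v * I - ρ‖
      = Real.log ‖s - ρ‖ + (I * ∫ y in (0 : ℝ)..v, 1 / (s + y * I - ρ)).re := by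
    intro ρ hρ
    have han : ∀ y ∈ Icc (0 : ℝ) v, AnalyticAt ℂ (fun z : ℂ => z - ρ) (s + y * I) :=
      fun y _ => analyticAt_id.sub analyticAt_const
    have h := eq_mul_exp_I_mul_integral_logDeriv (g := fun z : ℂ => z - ρ) (s := s) (u := 0) (v := v)
      (p := 0) (q := v) han (fun y hy => hne y hy ρ hρ) (left_mem_Icc.2 hv0.le) (right_mem_Icc.2 hv0.le)
    rw [hs0] at h
    have hderiv : ∀ y : ℝ, deriv (fun z : ℂ => z - ρ) (s + y * I) / (s + y * I - ρ)
        = 1 / (s + y * I - ρ) := by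
      intro y; rw [deriv_sub_const, deriv_id'']
    simp_rw [hderiv] at h
    have h0 : s - ρ ≠ 0 := by simpa using hne 0 (left_mem_Icc.2 hv0.le) ρ hρ
    rw [h, norm_mul, Complex.norm_exp, Real.log_mul (norm_ne_zero_iff.2 h0) (Real.exp_pos _).ne',
      Real.log_exp]
  -- `∫ G ρ = m(ρ) · ∫ dy/(s+iy−ρ)`
  have hGint : ∀ ρ ∈ Z, ∫ y in (0 : ℝ)..v, G ρ y
      = (discDivisor χ t ρ : ℂ) * ∫ y in (0 : ℝ)..v, 1 / (s + y * I - ρ) := by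
    intro ρ _
    rw [← intervalIntegral.integral_const_mul]
    refine intervalIntegral.integral_congr fun y _ => ?_
    simp only [hG]
    rw [div_eq_mul_one_div]
  -- assemble: the quantity to bound is `Re(i∫E)`
  have hkey : Real.log ‖L (s + v * I)‖ - Real.log ‖L s‖
      - ∑ ρ ∈ Z, (discDivisor χ t ρ : ℝ) * (Real.log ‖s + v * I - ρ‖ - Real.log ‖s - ρ‖)
      = (I * ∫ y in (0 : ℝ)..v, E y).re := by
    rw [hlogL, hdecomp, mul_add, Complex.add_re, Finset.mul_sum, Complex.re_sum]
    have hterm : ∀ ρ ∈ Z, (I * ∫ y in (0 : ℝ)..v, G ρ y).re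
        = (discDivisor χ t ρ : ℝ) * (Real.log ‖s + v * I - ρ‖ - Real.log ‖s - ρ‖) := by
      intro ρ hρ
      rw [hGint ρ hρ, hlogρ ρ hρ, add_sub_cancel_left, ← mul_assoc, mul_comm I, mul_assoc,
        ← Complex.ofReal_intCast, Complex.re_ofReal_mul]
    rw [Finset.sum_congr rfl hterm]
    ring
  rw [hkey]
  -- `|Re(i∫E)| ≤ ‖∫E‖ ≤ C ℒ v`
  have hint : ‖∫ y in (0 : ℝ)..v, E y‖ ≤ C * ℒ * |v - 0| :=
    intervalIntegral.norm_integral_le_of_norm_le_const fun y hy => by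
      rw [uIoc_of_le hv0.le] at hy
      exact hEb y ⟨hy.1.le, hy.2⟩
  rw [sub_zero, abs_of_pos hv0] at hint
  calc |(I * ∫ y in (0 : ℝ)..v, E y).re| ≤ ‖I * ∫ y in (0 : ℝ)..v, E y‖ := Complex.abs_re_le_norm _
    _ = ‖∫ y in (0 : ℝ)..v, E y‖ := by rw [norm_mul, Complex.norm_I, one_mul]
    _ ≤ C * ℒ * v := hint

/-! ### Lemma 5.9 under Proposition 2.2 (i)–(iii) on the disc -/

/-- A zero on the critical line seen from `σ + it`: `σ+it − ρ = (σ−1/2) + i(t − Im ρ)`. [folklore] -/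
private lemma sub_eq_of_re_eq_half {σ t : ℝ} {ρ : ℂ} (hρ : ρ.re = 1 / 2) :
    (σ : ℂ) + t * I - ρ = ((σ - 1 / 2 : ℝ) : ℂ) + ((t - ρ.im : ℝ) : ℂ) * I := by
  have hρeq : ρ = ((1 / 2 : ℝ) : ℂ) + (ρ.im : ℂ) * I := by
    apply Complex.ext <;> simp [hρ]
  conv_lhs => rw [hρeq]
  push_cast
  ring

/-- The shifted point: `σ+it+iy − ρ = (σ−1/2) + i(t − Im ρ + y)`. [folklore] -/
private lemma add_sub_eq_of_re_eq_half {σ t y : ℝ} {ρ : ℂ} (hρ : ρ.re = 1 / 2) :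
    (σ : ℂ) + t * I + y * I - ρ = ((σ - 1 / 2 : ℝ) : ℂ) + ((t - ρ.im + y : ℝ) : ℂ) * I := by
  have hρeq : ρ = ((1 / 2 : ℝ) : ℂ) + (ρ.im : ℂ) * I := by
    apply Complex.ext <;> simp [hρ]
  conv_lhs => rw [hρeq]
  push_cast
  ring

/-- For a zero on the critical line, `ρ = 1/2 + iγ`: `log|σ+it+iv − ρ| − log|σ+it − ρ|` is the
summand `logRatio (σ−1/2) v (t−γ)` of `Section5Lemma59ZeroSum`. [folklore] -/
private lemma log_norm_sub_eq_logRatio {σ t v : ℝ} {ρ : ℂ} (hρ : ρ.re = 1 / 2)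
    (h0 : (σ : ℂ) + t * I - ρ ≠ 0) (h1 : (σ : ℂ) + t * I + v * I - ρ ≠ 0) :
    Real.log ‖(σ : ℂ) + t * I + v * I - ρ‖ - Real.log ‖(σ : ℂ) + t * I - ρ‖
      = logRatio (σ - 1 / 2) v (t - ρ.im) := by
  have e0 := sub_eq_of_re_eq_half (σ := σ) (t := t) hρ
  have e1 := add_sub_eq_of_re_eq_half (σ := σ) (t := t) (y := v) hρ
  have hpos0 : 0 < (σ - 1 / 2) ^ 2 + (t - ρ.im) ^ 2 := by
    have : ‖(σ : ℂ) + t * I - ρ‖ ≠ 0 := norm_ne_zero_iff.2 h0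
    rw [e0, Complex.norm_add_mul_I] at this
    have h := (Real.sqrt_ne_zero'.1 this)
    exact h
  have hpos1 : 0 < (σ - 1 / 2) ^ 2 + (t - ρ.im + v) ^ 2 := by
    have : ‖(σ : ℂ) + t * I + v * I - ρ‖ ≠ 0 := norm_ne_zero_iff.2 h1
    rw [e1, Complex.norm_add_mul_I] at this
    exact Real.sqrt_ne_zero'.1 this
  rw [e0, e1, Complex.norm_add_mul_I, Complex.norm_add_mul_I, Real.log_sqrt hpos1.le,
    Real.log_sqrt hpos0.le, logRatio_def]
  ring

/-- **Lemma 5.9 under Proposition 2.2 (i)–(iii) on the Jensen disc**: with the absolute `C` of the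
tree's MV Lemma 12.1, for `χ ≠ χ₀` mod `q`, `s = σ+it` with `|σ − 1/2| ≤ α ≤ 1/100`, `0 < v ≤ 1/100`,
`L(·,χ)` zero-free on `[s, s+iv]`, and zeros `𝒵 = discZeros χ t` that are ON THE LINE (`Re ρ = 1/2`),
SIMPLE (`m(ρ) = 1`), `g`-SEPARATED in ordinate (`g > 0`) and at distance `≥ r` from `s`
(`0 < r ≤ 81/50`):
`log|L(s+iv)| − log|L(s)| ≤ Cℒv + ((r+v/2)/g+1)·½log((α²+(r+v)²)/r²) + v/r + (v/g)log((81/50)/r)`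
`  + (v²/2)(1/r²+1/(gr))`, `ℒ = log q + log(|t|+4)`. [cite: Zhang2022LandauSiegel, §5 Lemma 5.9] -/
theorem log_norm_sub_le_of_prop22 :
    ∃ C : ℝ, 0 < C ∧ ∀ (q : ℕ) [NeZero q] (χ : DirichletCharacter ℂ q), χ ≠ 1 →
      ∀ (σ t v α g r : ℝ), |σ - 1 / 2| ≤ α → α ≤ 1 / 100 → 0 < v → v ≤ 1 / 100 → 0 < g → 0 < r →
      r ≤ 81 / 50 →
      (∀ y ∈ Icc (0 : ℝ) v, χ.LFunction ((σ : ℂ) + t * I + y * I) ≠ 0) →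
      (∀ ρ ∈ discZeros χ t, ρ.re = 1 / 2) →
      (∀ ρ ∈ discZeros χ t, discDivisor χ t ρ = 1) →
      (∀ ρ ∈ discZeros χ t, ∀ ρ' ∈ discZeros χ t, ρ ≠ ρ' → g ≤ |ρ.im - ρ'.im|) →
      (∀ ρ ∈ discZeros χ t, r ≤ ‖(σ : ℂ) + t * I - ρ‖) →
      Real.log ‖χ.LFunction ((σ : ℂ) + t * I + v * I)‖ - Real.log ‖χ.LFunction ((σ : ℂ) + t * I)‖
        ≤ C * (Real.log q + Real.log (|t| + 4)) * v
          + (((r + v / 2) / g + 1) * (1 / 2 * Real.log ((α ^ 2 + (r + v) ^ 2) / r ^ 2))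
            + (v / r + v / g * Real.log ((81 / 50) / r)) + v ^ 2 / 2 * (1 / r ^ 2 + 1 / (g * r))) := by
  obtain ⟨C, hC0, hC⟩ := exists_abs_log_norm_sub_le
  refine ⟨C, hC0, ?_⟩
  intro q _ χ hχ σ t v α g r hσα hα hv0 hv1 hg hr hrR hseg hline hsimple hgap hdist
  have hσ : |σ - 1 / 2| ≤ 1 / 100 := hσα.trans hα
  have hstruct := hC q χ hχ σ t v hσ hv0 hv1 hseg
  set Z : Finset ℂ := discZeros χ t with hZ
  -- zeros are off the two endpoints
  have hne0 : ∀ ρ ∈ Z, (σ : ℂ) + t * I - ρ ≠ 0 := by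
    intro ρ hρ h
    have := hdist ρ hρ
    rw [h, norm_zero] at this
    linarith
  have hne1 : ∀ ρ ∈ Z, (σ : ℂ) + t * I + v * I - ρ ≠ 0 := by
    intro ρ hρ h
    rw [sub_eq_zero] at h
    have h0 := (discZeros_prop hχ hρ).1
    rw [← h] at h0
    exact hseg v (right_mem_Icc.2 hv0.le) h0
  -- rewrite the zero sum as a sum of `logRatio` over the ordinate differences
  set D : Finset ℝ := Z.image (fun ρ => t - ρ.im) with hD
  have hinj : Set.InjOn (fun ρ : ℂ => t - ρ.im) Z := by
    intro ρ hρ ρ' hρ' h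
    apply Complex.ext
    · rw [hline ρ hρ, hline ρ' hρ']
    · simpa using h
  have hsum : ∑ ρ ∈ Z, (discDivisor χ t ρ : ℝ) *
        (Real.log ‖(σ : ℂ) + t * I + v * I - ρ‖ - Real.log ‖(σ : ℂ) + t * I - ρ‖)
      = ∑ d ∈ D, logRatio (σ - 1 / 2) v d := by
    rw [hD, Finset.sum_image hinj]
    refine Finset.sum_congr rfl fun ρ hρ => ?_
    rw [hsimple ρ hρ, Int.cast_one, one_mul]
    exact log_norm_sub_eq_logRatio (hline ρ hρ) (hne0 ρ hρ) (hne1 ρ hρ)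
  -- hypotheses of the real-variable estimate
  have hsep : Separated g D := by
    intro x hx y hy hxy
    rw [hD, Finset.mem_image] at hx hy
    obtain ⟨ρ, hρ, rfl⟩ := hx
    obtain ⟨ρ', hρ', rfl⟩ := hy
    have hne : ρ ≠ ρ' := fun h => hxy (by rw [h])
    have := hgap ρ hρ ρ' hρ' hne
    rwa [show t - ρ.im - (t - ρ'.im) = -(ρ.im - ρ'.im) by ring, abs_neg]
  have hDprop : ∀ d ∈ D, |d| ≤ 81 / 50 ∧ r ^ 2 ≤ (σ - 1 / 2) ^ 2 + d ^ 2
      ∧ 0 < (σ - 1 / 2) ^ 2 + (d + v) ^ 2 := by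
    intro d hd
    rw [hD, Finset.mem_image] at hd
    obtain ⟨ρ, hρ, rfl⟩ := hd
    have hprop := discZeros_prop hχ hρ
    have e0 := sub_eq_of_re_eq_half (σ := σ) (t := t) (hline ρ hρ)
    have e1 := add_sub_eq_of_re_eq_half (σ := σ) (t := t) (y := v) (hline ρ hρ)
    refine ⟨?_, ?_, ?_⟩
    · rw [show t - ρ.im = -(ρ.im - t) by ring, abs_neg]; exact hprop.2.1
    · have h := hdist ρ hρ
      rw [e0, Complex.norm_add_mul_I] at h
      exact (Real.le_sqrt' hr).1 h
    · have h := norm_ne_zero_iff.2 (hne1 ρ hρ)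
      rw [e1, Complex.norm_add_mul_I] at h
      exact Real.sqrt_ne_zero'.1 h
  have hreal := sum_logRatio_le hg hr hrR hv0.le hσα D hsep hDprop
  -- combine with the structural bound
  have h1 := (abs_le.1 hstruct).2
  rw [hsum] at h1
  linarith

/-- **Lemma 5.9, exponentiated**: under the hypotheses of `log_norm_sub_le_of_prop22`,
`|L(s+iv,χ)| ≤ |L(s,χ)| · exp(Cℒv + B(r,v,g,α))` with the explicit `B` there.
[cite: Zhang2022LandauSiegel, §5 Lemma 5.9] -/
theorem norm_le_of_prop22 :
    ∃ C : ℝ, 0 < C ∧ ∀ (q : ℕ) [NeZero q] (χ : DirichletCharacter ℂ q), χ ≠ 1 →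
      ∀ (σ t v α g r : ℝ), |σ - 1 / 2| ≤ α → α ≤ 1 / 100 → 0 < v → v ≤ 1 / 100 → 0 < g → 0 < r →
      r ≤ 81 / 50 →
      (∀ y ∈ Icc (0 : ℝ) v, χ.LFunction ((σ : ℂ) + t * I + y * I) ≠ 0) →
      (∀ ρ ∈ discZeros χ t, ρ.re = 1 / 2) →
      (∀ ρ ∈ discZeros χ t, discDivisor χ t ρ = 1) →
      (∀ ρ ∈ discZeros χ t, ∀ ρ' ∈ discZeros χ t, ρ ≠ ρ' → g ≤ |ρ.im - ρ'.im|) →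
      (∀ ρ ∈ discZeros χ t, r ≤ ‖(σ : ℂ) + t * I - ρ‖) →
      ‖χ.LFunction ((σ : ℂ) + t * I + v * I)‖
        ≤ ‖χ.LFunction ((σ : ℂ) + t * I)‖ * Real.exp (C * (Real.log q + Real.log (|t| + 4)) * v
          + (((r + v / 2) / g + 1) * (1 / 2 * Real.log ((α ^ 2 + (r + v) ^ 2) / r ^ 2))
            + (v / r + v / g * Real.log ((81 / 50) / r)) + v ^ 2 / 2 * (1 / r ^ 2 + 1 / (g * r)))) := by
  obtain ⟨C, hC0, hC⟩ := log_norm_sub_le_of_prop22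
  refine ⟨C, hC0, ?_⟩
  intro q _ χ hχ σ t v α g r hσα hα hv0 hv1 hg hr hrR hseg hline hsimple hgap hdist
  have h := hC q χ hχ σ t v α g r hσα hα hv0 hv1 hg hr hrR hseg hline hsimple hgap hdist
  have hLs : 0 < ‖χ.LFunction ((σ : ℂ) + t * I)‖ := by
    have := hseg 0 (left_mem_Icc.2 hv0.le)
    simp only [Complex.ofReal_zero, zero_mul, add_zero] at this
    exact norm_pos_iff.2 this
  have hLsv : 0 < ‖χ.LFunction ((σ : ℂ) + t * I + v * I)‖ :=
    norm_pos_iff.2 (hseg v (right_mem_Icc.2 hv0.le))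
  rw [← Real.log_le_log_iff hLsv (mul_pos hLs (Real.exp_pos _)), Real.log_mul hLs.ne'
    (Real.exp_pos _).ne', Real.log_exp]
  linarith

/-! ### The form used on `𝔍(±α)` at (8.1) -/

/-- Crude numerical bound for the zero-sum terms at the manuscript's scales: for `0 < α ≤ 1/100`,
`α/2 ≤ g`, `0 < v ≤ g`, `v ≤ α`, with `r = α`,
`((α+v/2)/g+1)·½log((α²+(α+v)²)/α²) + v/α + (v/g)log((81/50)/α) + (v²/2)(1/α²+1/(gα)) ≤ 12 + log(1/α)`.
[folklore] -/
private lemma bookkeeping_le {α g v : ℝ} (hα0 : 0 < α) (hα : α ≤ 1 / 100) (hg : α / 2 ≤ g)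
    (hv0 : 0 < v) (hvg : v ≤ g) (hvα : v ≤ α) :
    ((α + v / 2) / g + 1) * (1 / 2 * Real.log ((α ^ 2 + (α + v) ^ 2) / α ^ 2))
      + (v / α + v / g * Real.log ((81 / 50) / α)) + v ^ 2 / 2 * (1 / α ^ 2 + 1 / (g * α))
      ≤ 12 + Real.log (1 / α) := by
  have hg0 : 0 < g := lt_of_lt_of_le (by positivity) hg
  -- term 1: count ≤ 4, each ≤ ½(5 − 1) = 2
  have hcount : (α + v / 2) / g + 1 ≤ 4 := by
    rw [div_add_one hg0.ne', div_le_iff₀ hg0]; nlinarith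
  have hlog5 : 1 / 2 * Real.log ((α ^ 2 + (α + v) ^ 2) / α ^ 2) ≤ 2 := by
    have hx : 0 < (α ^ 2 + (α + v) ^ 2) / α ^ 2 := by positivity
    have h1 := Real.log_le_sub_one_of_pos hx
    have h2 : (α ^ 2 + (α + v) ^ 2) / α ^ 2 ≤ 5 := by
      rw [div_le_iff₀ (by positivity)]; nlinarith
    linarith
  have hlog5' : 0 ≤ 1 / 2 * Real.log ((α ^ 2 + (α + v) ^ 2) / α ^ 2) := by
    refine mul_nonneg (by norm_num) (Real.log_nonneg ?_)
    rw [le_div_iff₀ (by positivity)]; nlinarith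
  have ht1 : ((α + v / 2) / g + 1) * (1 / 2 * Real.log ((α ^ 2 + (α + v) ^ 2) / α ^ 2)) ≤ 8 := by
    nlinarith
  -- term 2: v/α ≤ 1 and (v/g)·log(1.62/α) ≤ log(1/α) + 1
  have ht2a : v / α ≤ 1 := by rw [div_le_one hα0]; exact hvα
  have hvg1 : v / g ≤ 1 := by rw [div_le_one hg0]; exact hvg
  have hlogα : 0 ≤ Real.log (1 / α) := Real.log_nonneg (by rw [le_div_iff₀ hα0]; linarith)
  have hlog162 : Real.log ((81 / 50) / α) ≤ Real.log (1 / α) + 1 := by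
    rw [show (81 / 50 : ℝ) / α = (81 / 50) * (1 / α) by ring,
      Real.log_mul (by norm_num) (by positivity)]
    have : Real.log (81 / 50 : ℝ) ≤ 1 := by
      have := Real.log_le_sub_one_of_pos (show (0 : ℝ) < 81 / 50 by norm_num)
      linarith
    linarith
  have hlog162' : 0 ≤ Real.log ((81 / 50) / α) := Real.log_nonneg (by
    rw [le_div_iff₀ hα0]; linarith)
  have ht2b : v / g * Real.log ((81 / 50) / α) ≤ Real.log (1 / α) + 1 := by
    calc v / g * Real.log ((81 / 50) / α) ≤ 1 * Real.log ((81 / 50) / α) := by gcongr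
      _ ≤ Real.log (1 / α) + 1 := by rw [one_mul]; exact hlog162
  -- term 3: (v²/2)(1/α² + 1/(gα)) ≤ 3/2
  have ht3 : v ^ 2 / 2 * (1 / α ^ 2 + 1 / (g * α)) ≤ 3 / 2 := by
    have e : v ^ 2 / 2 * (1 / α ^ 2 + 1 / (g * α)) = 1 / 2 * ((v / α) ^ 2 + (v / g) * (v / α)) := by
      field_simp
    rw [e]
    have : 0 ≤ v / α := by positivity
    have : 0 ≤ v / g := by positivity
    nlinarith
  linarith

/-- **Lemma 5.9 on `𝔍(±α)`** (as used at (8.1)): with the absolute `C` of MV Lemma 12.1, for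
`χ ≠ χ₀` mod `q`, `s = σ + it` with `|σ − 1/2| = α` (so `|s − ρ| ≥ α` for zeros on the line),
`0 < α ≤ 1/100`, a shift `0 < v ≤ min(g, α)` and minimal gap `g ≥ α/2` (the manuscript:
`v = v₁ = α(1 − 5c′α𝓛)`, gaps `α + O(c′α²𝓛)`), and the disc zeros on the line, simple and
`g`-separated (the segment `[s, s+iv]` is then zero-free, `Re s ≠ 1/2`):
`|L(s+iv,χ)| ≤ |L(s,χ)| · exp(C(log q + log(|t|+4))·v + 12) / α` — i.e. `≪ log P` when
`(log q + log(|t|+4))·v = O(1)` and `1/α = (log P)/π` (2.10). [cite: Zhang2022LandauSiegel, §5 Lemma 5.9] -/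
theorem norm_le_on_J :
    ∃ C : ℝ, 0 < C ∧ ∀ (q : ℕ) [NeZero q] (χ : DirichletCharacter ℂ q), χ ≠ 1 →
      ∀ (σ t v α g : ℝ), |σ - 1 / 2| = α → 0 < α → α ≤ 1 / 100 → 0 < v → v ≤ g → v ≤ α →
      α / 2 ≤ g →
      (∀ ρ ∈ discZeros χ t, ρ.re = 1 / 2) →
      (∀ ρ ∈ discZeros χ t, discDivisor χ t ρ = 1) →
      (∀ ρ ∈ discZeros χ t, ∀ ρ' ∈ discZeros χ t, ρ ≠ ρ' → g ≤ |ρ.im - ρ'.im|) →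
      ‖χ.LFunction ((σ : ℂ) + t * I + v * I)‖
        ≤ ‖χ.LFunction ((σ : ℂ) + t * I)‖
          * (Real.exp (C * (Real.log q + Real.log (|t| + 4)) * v + 12) / α) := by
  obtain ⟨C, hC0, hC⟩ := norm_le_of_prop22
  refine ⟨C, hC0, ?_⟩
  intro q _ χ hχ σ t v α g hσα hα0 hα hv0 hvg hvα hg hline hsimple hgap
  have hg0 : 0 < g := lt_of_lt_of_le (by positivity) hg
  have hv1 : v ≤ 1 / 100 := hvα.trans hα
  have hσ : |σ - 1 / 2| ≤ 1 / 100 := hσα.le.trans hα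
  -- off the line the segment `[s, s+iv]` is zero-free: any zero on it would be a disc zero, hence
  -- on the critical line (Proposition 2.2 (i)), but `Re s = σ ≠ 1/2`
  have hseg : ∀ y ∈ Icc (0 : ℝ) v, χ.LFunction ((σ : ℂ) + t * I + y * I) ≠ 0 := by
    intro y hy h0
    have hmem : (σ : ℂ) + t * I + y * I ∈ discZeros χ t :=
      (mem_discZeros hχ).2 ⟨closedBall_subset_closedBall (by norm_num)
        (mem_disc hσ hy.1 (hy.2.trans hv1)), h0⟩
    have hre := hline _ hmem
    simp only [Complex.add_re, Complex.ofReal_re, Complex.mul_re, Complex.I_re, Complex.I_im,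
      Complex.ofReal_im, mul_zero, mul_one, sub_self, add_zero] at hre
    rw [hre, sub_self, abs_zero] at hσα
    exact hα0.ne' hσα.symm |>.elim
  -- on `𝔍(±α)` the distance to the line is exactly `α`
  have hdist : ∀ ρ ∈ discZeros χ t, α ≤ ‖(σ : ℂ) + t * I - ρ‖ := by
    intro ρ hρ
    have e0 := sub_eq_of_re_eq_half (σ := σ) (t := t) (hline ρ hρ)
    rw [e0]
    calc α = |σ - 1 / 2| := hσα.symm
      _ = |(((σ - 1 / 2 : ℝ) : ℂ) + ((t - ρ.im : ℝ) : ℂ) * I).re| := by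
          simp
      _ ≤ _ := Complex.abs_re_le_norm _
  have h := hC q χ hχ σ t v α g α hσα.le hα hv0 hv1 hg0 hα0 (by linarith) hseg hline hsimple hgap
    hdist
  have hbook := bookkeeping_le hα0 hα hg hv0 hvg hvα
  refine h.trans ?_
  have hL0 : 0 ≤ ‖χ.LFunction ((σ : ℂ) + t * I)‖ := norm_nonneg _
  gcongr
  rw [le_div_iff₀ hα0]
  calc Real.exp (C * (Real.log q + Real.log (|t| + 4)) * v
          + (((α + v / 2) / g + 1) * (1 / 2 * Real.log ((α ^ 2 + (α + v) ^ 2) / α ^ 2))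
            + (v / α + v / g * Real.log ((81 / 50) / α)) + v ^ 2 / 2 * (1 / α ^ 2 + 1 / (g * α)))) * α
      ≤ Real.exp (C * (Real.log q + Real.log (|t| + 4)) * v + (12 + Real.log (1 / α))) * α := by
        gcongr
    _ = Real.exp (C * (Real.log q + Real.log (|t| + 4)) * v + 12) := by
        rw [← add_assoc, Real.exp_add _ (Real.log (1 / α)), Real.exp_log (by positivity)]
        field_simp

end Lemma59

end Literature.NumberTheory.LFunctions.Zhang2022
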